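import Summits.RiemannHypothesis.RiemannHypothesis.Theorems.LiDirichletAsymptoticCharCount
import Summits.RiemannHypothesis.RiemannHypothesis.Theorems.LiDirichletAsymptoticLiSmoothMainTermChar
import HarnessLib

/-!
# RiemannHypothesis / LiDirichletAsymptotic — window sums against the smooth density: the REMAINDER IDENTITY
# (RH-FREE · GRH-FREE)

RH-FREE · GRH-FREE PROOF-OF-DATA (rung L-P(P1⁺χ)) [rh-li-prover].  Route `Theses/LiDirichletAsymptotic.lean`
(cell `pub/rh-li`); shared by `LiOscillatoryChar` (19628) and `LiFarTailsChar` (19632).  With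
`N(t) = lfunctionZeroCount χ t`, `M(t) = charCountMainExact χ t` (`M' = (2/π) g_χ` EXACTLY, `g_χ = charGammaDensity`,
from the tree's `hasDerivAt_gammaArgPhase`) and `R = N − M`, for `F ∈ C¹[a, b]`, `a ≤ b`:

  `∑_{a<|γ|≤b} m F(|γ|) − ∫_a^b F (2/π) g_χ = R(b) F(b) − R(a) F(a) − ∫_a^b R F'`   (`finsum_window_sub_integral_eq`)

(partial summation `CharCount.finsum_window_eq` + one integration by parts of the smooth part), hence
`|∑ − ∫ F M'| ≤ |R(b)||F(b)| + |R(a)||F(a)| + ∫_a^b |R||F'|` (`abs_finsum_window_sub_integral_le`).  RH-free identity;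
the remainder `R` is bounded pointwise elsewhere (`CharCount.abs_count_sub_exact_le_argSRem`, or BMOR).
Nothing here bears on the truth of RH or GRH.
-/

noncomputable section

-- D-0017: `Summit.<S>.<S>.…` is the designed namespace of a single-problem summit.
set_option linter.dupNamespace false

open MeasureTheory intervalIntegral Set Filter
open scoped Topology

namespace Summit.RiemannHypothesis.RiemannHypothesis.Theorems.LiTheory

open Literature.NumberTheory.LFunctions Literature.NumberTheory.LFunctions.ExplicitPsiChar
open Literature.NumberTheory.LFunctions.DirichletTheta
open Literature.NumberTheory.LFunctions.DirichletDisc (zeroOrder)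
open Complex (I)

namespace CharCount

variable {q : ℕ} [NeZero q] {χ : DirichletCharacter ℂ q}

/-! ### The exact main term is a primitive of `(2/π) g_χ` -/

/-- `g_χ` is continuous. -/
theorem continuous_charGammaDensity (χ : DirichletCharacter ℂ q) : Continuous (charGammaDensity χ) := by
  have e : charGammaDensity χ =
      fun t : ℝ ↦ (logDeriv Complex.Gammaℝ (1 / 2 + (charParity χ : ℂ) + (t : ℂ) * I)).re + Real.log q / 2 :=
    funext fun t ↦ SmoothChar.charGammaDensity_eq χ t
  rw [e]
  exact (continuous_re_logDeriv_Gammaℝ_line _).add continuous_const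

/-- **`d/dt charCountMainExact χ t = (2/π) g_χ(t)`** (the `Γ`-phase has derivative `Re (Γ_ℝ'/Γ_ℝ)(½ + a + it)`,
`hasDerivAt_gammaArgPhase`, and `g_χ = Re (Γ_ℝ'/Γ_ℝ) + ½ log q`). -/
theorem hasDerivAt_charCountMainExact (χ : DirichletCharacter ℂ q) (t : ℝ) :
    HasDerivAt (charCountMainExact χ) (2 / Real.pi * charGammaDensity χ t) t := by
  have hθ := hasDerivAt_gammaArgPhase (charParity χ) t
  have h : HasDerivAt (fun s : ℝ ↦ (2 * gammaArgPhase (charParity χ) s + s * Real.log q) / Real.pi)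
      ((2 * (logDeriv Complex.Gammaℝ (1 / 2 + (charParity χ : ℂ) + t * I)).re + 1 * Real.log q) / Real.pi) t :=
    ((hθ.const_mul 2).add ((hasDerivAt_id t).mul_const _)).div_const _
  have e : charCountMainExact χ = fun s : ℝ ↦ (2 * gammaArgPhase (charParity χ) s + s * Real.log q) / Real.pi := by
    funext s; rfl
  rw [e]
  refine h.congr_deriv ?_
  rw [SmoothChar.charGammaDensity_eq]
  ring

/-! ### The remainder identity -/

/-- **Remainder identity** (RH-free): for `χ ≠ χ₀`, `a ≤ b`, `F ∈ C¹[a, b]`,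
`∑_{a<|γ|≤b} m F(|γ|) − ∫_a^b F·(2/π)g_χ = R(b)F(b) − R(a)F(a) − ∫_a^b R F'`, `R = N − charCountMainExact`. -/
theorem finsum_window_sub_integral_eq (hχ1 : χ ≠ 1) {a b : ℝ} (hab : a ≤ b) {F F' : ℝ → ℝ}
    (hF : ∀ t ∈ Icc a b, HasDerivAt F (F' t) t) (hF' : ContinuousOn F' (Icc a b)) :
    (∑ᶠ ρ ∈ lfunctionZeroBox χ b \ lfunctionZeroBox χ a, (zeroOrder χ ρ : ℝ) * F |ρ.im|) -
        ∫ t in a..b, F t * (2 / Real.pi * charGammaDensity χ t) =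
      ((lfunctionZeroCount χ b : ℝ) - charCountMainExact χ b) * F b -
        ((lfunctionZeroCount χ a : ℝ) - charCountMainExact χ a) * F a -
        ∫ t in a..b, ((lfunctionZeroCount χ t : ℝ) - charCountMainExact χ t) * F' t := by
  rw [finsum_window_eq hχ1 hab hF hF']
  have hIcc : uIcc a b = Icc a b := uIcc_of_le hab
  have hF_u : ∀ t ∈ uIcc a b, HasDerivAt F (F' t) t := fun t ht ↦ hF t (by rwa [hIcc] at ht)
  have hF'i : IntervalIntegrable F' volume a b := hF'.intervalIntegrable_of_Icc hab
  have hFc : ContinuousOn F (uIcc a b) := fun t ht ↦ (hF_u t ht).continuousAt.continuousWithinAt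
  have hgc := continuous_charGammaDensity χ
  have hMc := continuous_charCountMainExact χ
  -- by parts for the smooth part
  have hparts : ∫ t in a..b, (charCountMainExact χ t - charCountMainExact χ a) * F' t =
      (charCountMainExact χ b - charCountMainExact χ a) * F b -
        ∫ t in a..b, (2 / Real.pi * charGammaDensity χ t) * F t := by
    have h := intervalIntegral.integral_mul_deriv_eq_deriv_mul (a := a) (b := b)
      (u := fun t ↦ charCountMainExact χ t - charCountMainExact χ a)
      (u' := fun t ↦ 2 / Real.pi * charGammaDensity χ t) (v := F) (v' := F')
      (fun t _ ↦ (hasDerivAt_charCountMainExact χ t).sub_const _) hF_u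
      (continuous_const.mul hgc).continuousOn.intervalIntegrable hF'i
    rw [h]
    simp
  -- integrability of the pieces
  have hN : IntervalIntegrable (fun t ↦ ((lfunctionZeroCount χ t : ℝ) - lfunctionZeroCount χ a) * F' t) volume a b :=
    intervalIntegrable_count_sub_mul hχ1 (by rwa [hIcc])
  have hM : IntervalIntegrable (fun t ↦ (charCountMainExact χ t - charCountMainExact χ a) * F' t) volume a b :=
    ((hMc.continuousOn.sub continuousOn_const).mul hF').intervalIntegrable_of_Icc hab
  have hsplit : ∫ t in a..b, ((lfunctionZeroCount χ t : ℝ) - charCountMainExact χ t) * F' t =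
      (∫ t in a..b, ((lfunctionZeroCount χ t : ℝ) - lfunctionZeroCount χ a) * F' t) -
        (∫ t in a..b, (charCountMainExact χ t - charCountMainExact χ a) * F' t) +
        ((lfunctionZeroCount χ a : ℝ) - charCountMainExact χ a) * ∫ t in a..b, F' t := by
    rw [← intervalIntegral.integral_sub hN hM, ← intervalIntegral.integral_const_mul,
      ← intervalIntegral.integral_add (hN.sub hM) (hF'i.const_mul _)]
    exact intervalIntegral.integral_congr fun t _ ↦ by ring
  have hff : ∫ t in a..b, F' t = F b - F a := integral_eq_sub_of_hasDerivAt hF_u hF'i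
  have hcomm : (∫ t in a..b, (2 / Real.pi * charGammaDensity χ t) * F t) =
      ∫ t in a..b, F t * (2 / Real.pi * charGammaDensity χ t) :=
    intervalIntegral.integral_congr fun t _ ↦ mul_comm _ _
  rw [hsplit, hparts, hff, hcomm]
  ring

/-- `R · G` is interval integrable for continuous `G` (`N` monotone, `M` continuous). -/
theorem intervalIntegrable_remainder_mul (hχ1 : χ ≠ 1) {a b : ℝ} {G : ℝ → ℝ} (hG : ContinuousOn G (uIcc a b)) :
    IntervalIntegrable (fun t ↦ ((lfunctionZeroCount χ t : ℝ) - charCountMainExact χ t) * G t) volume a b := by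
  have h1 : IntervalIntegrable (fun t ↦ ((lfunctionZeroCount χ t : ℝ) - lfunctionZeroCount χ a) * G t) volume a b :=
    intervalIntegrable_count_sub_mul hχ1 hG
  have h2 : IntervalIntegrable (fun t ↦ ((lfunctionZeroCount χ a : ℝ) - charCountMainExact χ t) * G t) volume a b :=
    ((continuousOn_const.sub (continuous_charCountMainExact χ).continuousOn).mul hG).intervalIntegrable
  exact (h1.add h2).congr fun t _ ↦ by ring

/-- **Remainder bound**: `|∑_{a<|γ|≤b} m F(|γ|) − ∫_a^b F·(2/π)g_χ| ≤ |R(b)||F(b)| + |R(a)||F(a)| + ∫_a^b |R||F'|`. -/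
theorem abs_finsum_window_sub_integral_le (hχ1 : χ ≠ 1) {a b : ℝ} (hab : a ≤ b) {F F' : ℝ → ℝ}
    (hF : ∀ t ∈ Icc a b, HasDerivAt F (F' t) t) (hF' : ContinuousOn F' (Icc a b)) :
    |(∑ᶠ ρ ∈ lfunctionZeroBox χ b \ lfunctionZeroBox χ a, (zeroOrder χ ρ : ℝ) * F |ρ.im|) -
        ∫ t in a..b, F t * (2 / Real.pi * charGammaDensity χ t)| ≤
      |(lfunctionZeroCount χ b : ℝ) - charCountMainExact χ b| * |F b| +
        |(lfunctionZeroCount χ a : ℝ) - charCountMainExact χ a| * |F a| +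
        ∫ t in a..b, |(lfunctionZeroCount χ t : ℝ) - charCountMainExact χ t| * |F' t| := by
  rw [finsum_window_sub_integral_eq hχ1 hab hF hF']
  have hint : IntervalIntegrable (fun t ↦ ((lfunctionZeroCount χ t : ℝ) - charCountMainExact χ t) * F' t)
      volume a b := intervalIntegrable_remainder_mul hχ1 (by rwa [uIcc_of_le hab])
  have hI : |∫ t in a..b, ((lfunctionZeroCount χ t : ℝ) - charCountMainExact χ t) * F' t| ≤
      ∫ t in a..b, |(lfunctionZeroCount χ t : ℝ) - charCountMainExact χ t| * |F' t| := by
    have h := intervalIntegral.abs_integral_le_integral_abs (μ := volume) (f := fun t ↦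
      ((lfunctionZeroCount χ t : ℝ) - charCountMainExact χ t) * F' t) hab
    refine h.trans (le_of_eq ?_)
    exact intervalIntegral.integral_congr fun t _ ↦ abs_mul _ _
  calc |((lfunctionZeroCount χ b : ℝ) - charCountMainExact χ b) * F b -
          ((lfunctionZeroCount χ a : ℝ) - charCountMainExact χ a) * F a -
          ∫ t in a..b, ((lfunctionZeroCount χ t : ℝ) - charCountMainExact χ t) * F' t|
      ≤ |((lfunctionZeroCount χ b : ℝ) - charCountMainExact χ b) * F b -
          ((lfunctionZeroCount χ a : ℝ) - charCountMainExact χ a) * F a| +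
          |∫ t in a..b, ((lfunctionZeroCount χ t : ℝ) - charCountMainExact χ t) * F' t| := abs_sub _ _
    _ ≤ |((lfunctionZeroCount χ b : ℝ) - charCountMainExact χ b) * F b| +
          |((lfunctionZeroCount χ a : ℝ) - charCountMainExact χ a) * F a| +
          |∫ t in a..b, ((lfunctionZeroCount χ t : ℝ) - charCountMainExact χ t) * F' t| := by
        linarith [abs_sub (((lfunctionZeroCount χ b : ℝ) - charCountMainExact χ b) * F b)
          (((lfunctionZeroCount χ a : ℝ) - charCountMainExact χ a) * F a)]
    _ ≤ _ := by rw [abs_mul, abs_mul]; linarith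

end CharCount

end Summit.RiemannHypothesis.RiemannHypothesis.Theorems.LiTheory

end
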